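import Mathlib
import HarnessLib
import Summits.ValiantsHypothesis.ValiantsHypothesis.Theorems.LacunarySymmetroidMatrixDescartesOsculationLawRecursionInvariance
import Summits.ValiantsHypothesis.ValiantsHypothesis.Theorems.LacunarySymmetroidMatrixDescartesOsculationLawRecursionWitnessCurve

/-!
# ValiantsHypothesis / LacunarySymmetroid — crux `MatrixDescartes` (stmt-ValiantsHypothesis-18050, V1),
# line `Cruxes/MatrixDescartes/Lines/osculation_law.lean` («osculation-law»), stub `stub_recursion`, R6(a) witness:
# PENCILS OF DIAGONAL LETTERS

The explicit witnesses for the NON-EMPTINESS of the node general-position family (ROUTE′ (4), val-lit-p7 g13's memo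
`HOME/lmr/NOTE-p7g13-18050-GP-density-sizing.md` §3; builders p4/p7/p8/port-3, desk RULING #286) are pencils whose
letters are DIAGONAL, `S_l = diag_i(−A_{i,l})`.  For such a pencil on the index type `Fin m ⊕ Fin 0` everything is
explicit:
* `pencil_diagonal`, `det_pencil_diagonal`, `eval_det_pencil_diagonal` — `det Σ_l t^{e_l} S_l = Π_i (−Σ_l A_{i,l} t^{e_l})`;
* `sum_mul_pow_ne_zero`, `det_pencil_diagonal_ne_zero`, `posRoots_det_pencil_diagonal_eq_zero` — if every row of
  `A` has coefficients of ONE sign (`≥ 0` or `≤ 0`), not all zero, the determinant is a nonzero polynomial without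
  positive roots;
* `mvPencil_diagonal`, `eval_det_mvPencil_diagonal` — the spectral polynomial is `Φ(t,b) = Π_i (b − β_i(t))` with the
  polynomial branches `β_i(t) = Σ_l A_{i,l} t^{e_l}`;
* `exists_pos_forall_sum_ne` — distinct rows have pairwise distinct branch values at some `t > 0`;
* `hasDerivAt_eval_det_mvPencil_diagonal`, `diagonal_fibre_simple` — if the branches are pairwise distinct at the
  abscissa `t > 0` (`hsep`) and every row of `A` has one sign with two nonzero entries at distinct exponents, then at
  every zero `(t,b)` over `t`,
  `t > 0`, of `Φ` one has `∂_bΦ(t,b) ≠ 0` AND `H(Φ)(t,b) ≠ 0` (engine: `eval_logHessian_ne_zero_of_polynomial_branch`)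
  — so the fibres `Φ(t,·)`, `H(Φ)(t,·)` have no common root, and
* `osc_diagonal_eq_empty` — the osculation set (the line's set-builder text, with `Φ` abstracted) is EMPTY;
* `isCoprime_X_pow_add_C`, `separable_prod_X_pow_add_C`, `separable_prod_neg_X_pow_add_C` — `±Π_i (X^n + w_i)` is
  separable for `n ≠ 0` and distinct nonzero `w_i` (the Zariski certificate «`det G` squarefree» of the witness).
Honest framing: helper lemmas toward the OPEN stub `stub_recursion` (its general-position residue); the osculation
LAW, `MatrixDescartes`, Conjecture B and `VP ≠ VNP` are NOT proved.  No definitions, no named facts.  (val-lit-p4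
g13, helper `--supports stmt-ValiantsHypothesis-18050`.)
-/

-- `Summit.ValiantsHypothesis.ValiantsHypothesis.…` is the tree's mandated single-conjunct layout (Sub = Summit).
set_option linter.dupNamespace false

noncomputable section

namespace Summit.ValiantsHypothesis.ValiantsHypothesis.Theorems.LacunarySymmetroidMatrixDescartes

open Polynomial Set
open MvPolynomial (pderiv)
open scoped BigOperators Matrix

namespace OsculationRecursion

/-! ### The one-variable pencil of diagonal letters -/

/-- A pencil of DIAGONAL letters `S_l = diag_i(−A_{i,l})` is diagonal:
`Σ_l X^{e_l}·C(S_l) = diag_i(−Σ_l C(A_{i,l}) X^{e_l})`. [folklore] -/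
theorem pencil_diagonal {ι : Type*} [Fintype ι] [DecidableEq ι] {K : ℕ} (e : Fin K → ℕ) (A : ι → Fin K → ℝ)
    (S : Fin K → Matrix ι ι ℝ) (hS : ∀ l, S l = Matrix.diagonal fun i => -A i l) :
    (∑ l, (X : ℝ[X]) ^ e l • (S l).map Polynomial.C) =
      Matrix.diagonal fun i => -∑ l, Polynomial.C (A i l) * X ^ e l := by
  refine Matrix.ext fun i j => ?_
  simp only [Matrix.sum_apply, Matrix.smul_apply, Matrix.map_apply, hS, smul_eq_mul]
  by_cases h : i = j
  · subst h
    simp only [Matrix.diagonal_apply_eq, map_neg, mul_neg, Finset.sum_neg_distrib]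
    exact congrArg Neg.neg (Finset.sum_congr rfl fun l _ => mul_comm _ _)
  · simp only [Matrix.diagonal_apply_ne _ h, map_zero, mul_zero, Finset.sum_const_zero]

/-- `det Σ_l X^{e_l}·C(S_l) = Π_i (−Σ_l C(A_{i,l}) X^{e_l})` for diagonal letters. [folklore] -/
theorem det_pencil_diagonal {ι : Type*} [Fintype ι] [DecidableEq ι] {K : ℕ} (e : Fin K → ℕ) (A : ι → Fin K → ℝ)
    (S : Fin K → Matrix ι ι ℝ) (hS : ∀ l, S l = Matrix.diagonal fun i => -A i l) :
    (∑ l, (X : ℝ[X]) ^ e l • (S l).map Polynomial.C).det = ∏ i, -∑ l, Polynomial.C (A i l) * X ^ e l := by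
  rw [pencil_diagonal e A S hS, Matrix.det_diagonal]

/-- … evaluated: `det(Σ_l t^{e_l} S_l) = Π_i (−Σ_l A_{i,l} t^{e_l})`. [folklore] -/
theorem eval_det_pencil_diagonal {ι : Type*} [Fintype ι] [DecidableEq ι] {K : ℕ} (e : Fin K → ℕ)
    (A : ι → Fin K → ℝ) (S : Fin K → Matrix ι ι ℝ) (hS : ∀ l, S l = Matrix.diagonal fun i => -A i l) (t : ℝ) :
    (∑ l, (X : ℝ[X]) ^ e l • (S l).map Polynomial.C).det.eval t = ∏ i, -∑ l, A i l * t ^ e l := by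
  rw [det_pencil_diagonal e A S hS, eval_prod]
  refine Finset.prod_congr rfl fun i _ => ?_
  rw [eval_neg, eval_finsetSum]
  exact congrArg Neg.neg (Finset.sum_congr rfl fun l _ => by rw [eval_mul, eval_C, eval_pow, eval_X])

/-- A sum of monomials with coefficients of ONE sign, not all zero, does not vanish at `t > 0`. [folklore] -/
theorem sum_mul_pow_ne_zero {K : ℕ} (a : Fin K → ℝ) (e : Fin K → ℕ) {l₁ : Fin K}
    (ha : ((∀ l, 0 ≤ a l) ∧ 0 < a l₁) ∨ ((∀ l, a l ≤ 0) ∧ a l₁ < 0)) {t : ℝ} (ht : 0 < t) :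
    ∑ l, a l * t ^ e l ≠ 0 := by
  rcases ha with ⟨ha, h₁⟩ | ⟨ha, h₁⟩
  · exact (Finset.sum_pos' (fun l _ => mul_nonneg (ha l) (pow_pos ht _).le)
      ⟨l₁, Finset.mem_univ _, mul_pos h₁ (pow_pos ht _)⟩).ne'
  · have : 0 < ∑ l, -(a l * t ^ e l) :=
      Finset.sum_pos' (fun l _ => neg_nonneg.2 (mul_nonpos_of_nonpos_of_nonneg (ha l) (pow_pos ht _).le))
        ⟨l₁, Finset.mem_univ _, neg_pos.2 (mul_neg_of_neg_of_pos h₁ (pow_pos ht _))⟩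
    rw [Finset.sum_neg_distrib] at this
    exact (neg_pos.1 this).ne

/-- **One-sign rows ⇒ `det ≢ 0`.** [folklore] -/
theorem det_pencil_diagonal_ne_zero {ι : Type*} [Fintype ι] [DecidableEq ι] {K : ℕ}
    (e : Fin K → ℕ) (A : ι → Fin K → ℝ)
    (hsign : ∀ i, ∃ l₁, ((∀ l, 0 ≤ A i l) ∧ 0 < A i l₁) ∨ ((∀ l, A i l ≤ 0) ∧ A i l₁ < 0))
    (S : Fin K → Matrix ι ι ℝ) (hS : ∀ l, S l = Matrix.diagonal fun i => -A i l) :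
    (∑ l, (X : ℝ[X]) ^ e l • (S l).map Polynomial.C).det ≠ 0 := by
  intro h0
  have h1 : (∑ l, (X : ℝ[X]) ^ e l • (S l).map Polynomial.C).det.eval 1 = 0 := by rw [h0, eval_zero]
  rw [eval_det_pencil_diagonal e A S hS 1] at h1
  obtain ⟨i, -, hi⟩ := Finset.prod_eq_zero_iff.1 h1
  obtain ⟨l₁, hl₁⟩ := hsign i
  exact sum_mul_pow_ne_zero (A i) e hl₁ one_pos (neg_eq_zero.1 hi)

/-- **One-sign rows ⇒ no positive roots** (with multiplicity). [folklore] -/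
theorem posRoots_det_pencil_diagonal_eq_zero {ι : Type*} [Fintype ι] [DecidableEq ι] {K : ℕ}
    (e : Fin K → ℕ) (A : ι → Fin K → ℝ)
    (hsign : ∀ i, ∃ l₁, ((∀ l, 0 ≤ A i l) ∧ 0 < A i l₁) ∨ ((∀ l, A i l ≤ 0) ∧ A i l₁ < 0))
    (S : Fin K → Matrix ι ι ℝ) (hS : ∀ l, S l = Matrix.diagonal fun i => -A i l) :
    (∑ l, (X : ℝ[X]) ^ e l • (S l).map Polynomial.C).det.roots.filter (fun t => 0 < t) = 0 := by
  refine Multiset.filter_eq_nil.2 fun t ht h0 => ?_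
  have hroot := ((mem_roots').1 ht).2
  rw [IsRoot.def, eval_det_pencil_diagonal e A S hS t] at hroot
  obtain ⟨i, -, hi⟩ := Finset.prod_eq_zero_iff.1 hroot
  obtain ⟨l₁, hl₁⟩ := hsign i
  exact sum_mul_pow_ne_zero (A i) e hl₁ h0 (neg_eq_zero.1 hi)

/-- **A good abscissa.**  If the exponents are distinct and any two rows of `A` differ somewhere, then at some
`t > 0` all the branch values `Σ_l A_{i,l} t^{e_l}` are pairwise distinct (each difference is a nonzero polynomial,
so all but finitely many `t` work). [folklore] -/
theorem exists_pos_forall_sum_ne {ι : Type*} [Fintype ι] {K : ℕ} (e : Fin K → ℕ) (he : Function.Injective e)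
    (A : ι → Fin K → ℝ) (hA : ∀ i j, i ≠ j → ∃ l, A i l ≠ A j l) :
    ∃ t : ℝ, 0 < t ∧ ∀ i j, i ≠ j → ∑ l, A i l * t ^ e l ≠ ∑ l, A j l * t ^ e l := by
  classical
  -- the difference polynomials and their (finitely many) roots
  set P : ι → ι → ℝ[X] := fun i j => ∑ l, Polynomial.C (A i l - A j l) * X ^ e l with hP
  have hPne : ∀ i j, i ≠ j → P i j ≠ 0 := by
    intro i j hij h0
    obtain ⟨l₀, hl₀⟩ := hA i j hij
    have hc : (P i j).coeff (e l₀) = A i l₀ - A j l₀ := by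
      rw [hP, finsetSum_coeff, Finset.sum_eq_single l₀]
      · rw [coeff_C_mul, coeff_X_pow, if_pos rfl, mul_one]
      · intro l _ hl
        rw [coeff_C_mul, coeff_X_pow, if_neg (fun h => hl (he h).symm), mul_zero]
      · exact fun h => absurd (Finset.mem_univ _) h
    rw [h0, coeff_zero] at hc
    exact sub_ne_zero.2 hl₀ hc.symm
  set B : Finset ℝ := Finset.univ.biUnion fun q : ι × ι => (P q.1 q.2).roots.toFinset with hB
  obtain ⟨t, ht, htB⟩ := Set.Infinite.exists_notMem_finset (Set.Ioi_infinite (0 : ℝ)) B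
  refine ⟨t, ht, fun i j hij h => htB ?_⟩
  rw [hB, Finset.mem_biUnion]
  refine ⟨(i, j), Finset.mem_univ _, ?_⟩
  rw [Multiset.mem_toFinset, mem_roots (hPne i j hij), IsRoot.def, hP, eval_finsetSum]
  simp only [eval_mul, eval_C, eval_pow, eval_X, sub_mul, Finset.sum_sub_distrib]
  exact sub_eq_zero.2 h

/-! ### The two-variable spectral polynomial of a pencil of diagonal letters -/

/-- The bordered matrix `Σ_l X₀^{e_l}·C(S_l) + X₁·C(I ⊕ 0)` of a pencil of diagonal letters on `Fin m ⊕ Fin 0` is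
`diag_i(X₁ − Σ_l C(A_{i,l}) X₀^{e_l})`. [folklore] -/
theorem mvPencil_diagonal (m : ℕ) {K : ℕ} (e : Fin K → ℕ) (A : (Fin m ⊕ Fin 0) → Fin K → ℝ)
    (S : Fin K → Matrix (Fin m ⊕ Fin 0) (Fin m ⊕ Fin 0) ℝ) (hS : ∀ l, S l = Matrix.diagonal fun i => -A i l) :
    (∑ l, (MvPolynomial.X (0 : Fin 2) : MvPolynomial (Fin 2) ℝ) ^ e l •
          (S l).map (MvPolynomial.C : ℝ →+* MvPolynomial (Fin 2) ℝ)
        + (MvPolynomial.X (1 : Fin 2) : MvPolynomial (Fin 2) ℝ) •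
          (Matrix.fromBlocks 1 0 0 0 : Matrix (Fin m ⊕ Fin 0) (Fin m ⊕ Fin 0) ℝ).map
            (MvPolynomial.C : ℝ →+* MvPolynomial (Fin 2) ℝ)) =
      Matrix.diagonal fun i => MvPolynomial.X 1 - ∑ l, MvPolynomial.C (A i l) * MvPolynomial.X 0 ^ e l := by
  rw [fromBlocks_one_sum_fin_zero, Matrix.map_one _ (map_zero _) (map_one _)]
  refine Matrix.ext fun i j => ?_
  simp only [Matrix.add_apply, Matrix.sum_apply, Matrix.smul_apply, Matrix.map_apply, hS, smul_eq_mul]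
  by_cases h : i = j
  · subst h
    simp only [Matrix.diagonal_apply_eq, Matrix.one_apply_eq, map_neg, mul_neg, Finset.sum_neg_distrib, mul_one]
    rw [sub_eq_neg_add]
    exact congrArg₂ (· + ·) (congrArg Neg.neg (Finset.sum_congr rfl fun l _ => mul_comm _ _)) rfl
  · simp only [Matrix.diagonal_apply_ne _ h, Matrix.one_apply_ne h, map_zero, mul_zero, Finset.sum_const_zero,
      add_zero]

/-- **`Φ(t,b) = Π_i (b − β_i(t))`**, `β_i(t) = Σ_l A_{i,l} t^{e_l}`, for a pencil of diagonal letters. [folklore] -/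
theorem eval_det_mvPencil_diagonal (m : ℕ) {K : ℕ} (e : Fin K → ℕ) (A : (Fin m ⊕ Fin 0) → Fin K → ℝ)
    (S : Fin K → Matrix (Fin m ⊕ Fin 0) (Fin m ⊕ Fin 0) ℝ) (hS : ∀ l, S l = Matrix.diagonal fun i => -A i l)
    (p : Fin 2 → ℝ) :
    MvPolynomial.eval p (∑ l, (MvPolynomial.X (0 : Fin 2) : MvPolynomial (Fin 2) ℝ) ^ e l •
          (S l).map (MvPolynomial.C : ℝ →+* MvPolynomial (Fin 2) ℝ)
        + (MvPolynomial.X (1 : Fin 2) : MvPolynomial (Fin 2) ℝ) •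
          (Matrix.fromBlocks 1 0 0 0 : Matrix (Fin m ⊕ Fin 0) (Fin m ⊕ Fin 0) ℝ).map
            (MvPolynomial.C : ℝ →+* MvPolynomial (Fin 2) ℝ)).det =
      ∏ i, (p 1 - ∑ l, A i l * p 0 ^ e l) := by
  rw [mvPencil_diagonal m e A S hS, Matrix.det_diagonal, map_prod]
  refine Finset.prod_congr rfl fun i _ => ?_
  simp only [map_sub, map_sum, map_mul, map_pow, MvPolynomial.eval_C, MvPolynomial.eval_X]

/-- **`∂_b Φ(t, β_i(t)) = Π_{j ≠ i} (β_i(t) − β_j(t))`** for a pencil of diagonal letters. [folklore] -/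
theorem hasDerivAt_eval_det_mvPencil_diagonal (m : ℕ) {K : ℕ} (e : Fin K → ℕ) (A : (Fin m ⊕ Fin 0) → Fin K → ℝ)
    (S : Fin K → Matrix (Fin m ⊕ Fin 0) (Fin m ⊕ Fin 0) ℝ) (hS : ∀ l, S l = Matrix.diagonal fun i => -A i l)
    (t : ℝ) (i : Fin m ⊕ Fin 0) :
    HasDerivAt (fun b => MvPolynomial.eval ![t, b]
        (∑ l, (MvPolynomial.X (0 : Fin 2) : MvPolynomial (Fin 2) ℝ) ^ e l •
          (S l).map (MvPolynomial.C : ℝ →+* MvPolynomial (Fin 2) ℝ)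
        + (MvPolynomial.X (1 : Fin 2) : MvPolynomial (Fin 2) ℝ) •
          (Matrix.fromBlocks 1 0 0 0 : Matrix (Fin m ⊕ Fin 0) (Fin m ⊕ Fin 0) ℝ).map
            (MvPolynomial.C : ℝ →+* MvPolynomial (Fin 2) ℝ)).det)
      (∏ j ∈ Finset.univ.erase i, (∑ l, A i l * t ^ e l - ∑ l, A j l * t ^ e l)) (∑ l, A i l * t ^ e l) := by
  have hF : (fun b => MvPolynomial.eval ![t, b]
        (∑ l, (MvPolynomial.X (0 : Fin 2) : MvPolynomial (Fin 2) ℝ) ^ e l •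
          (S l).map (MvPolynomial.C : ℝ →+* MvPolynomial (Fin 2) ℝ)
        + (MvPolynomial.X (1 : Fin 2) : MvPolynomial (Fin 2) ℝ) •
          (Matrix.fromBlocks 1 0 0 0 : Matrix (Fin m ⊕ Fin 0) (Fin m ⊕ Fin 0) ℝ).map
            (MvPolynomial.C : ℝ →+* MvPolynomial (Fin 2) ℝ)).det) =
      ∏ j, fun b : ℝ => b - ∑ l, A j l * t ^ e l := by
    funext b
    rw [eval_det_mvPencil_diagonal m e A S hS, Finset.prod_apply]
    simp only [Matrix.cons_val_one, Matrix.cons_val_zero]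
  rw [hF]
  have h := HasDerivAt.finsetProd (u := Finset.univ) (f := fun j (b : ℝ) => b - ∑ l, A j l * t ^ e l)
    (f' := fun _ => (1 : ℝ)) (x := ∑ l, A i l * t ^ e l) (fun j _ => (hasDerivAt_id' _).sub_const _)
  have hsum : ∑ i' ∈ Finset.univ, (∏ j ∈ Finset.univ.erase i',
      (fun j (b : ℝ) => b - ∑ l, A j l * t ^ e l) j (∑ l, A i l * t ^ e l)) • (fun _ => (1 : ℝ)) i' =
      ∏ j ∈ Finset.univ.erase i, (∑ l, A i l * t ^ e l - ∑ l, A j l * t ^ e l) := by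
    rw [Finset.sum_eq_single i]
    · rw [smul_eq_mul, mul_one]
    · intro j _ hji
      rw [Finset.prod_eq_zero (Finset.mem_erase.2 ⟨Ne.symm hji, Finset.mem_univ i⟩) (sub_self _), zero_smul]
    · exact fun hi => absurd (Finset.mem_univ i) hi
  rw [hsum] at h
  exact h

/-- **Simple fibres.**  For a pencil of diagonal letters on `Fin m ⊕ Fin 0`, every row of one sign with two nonzero
entries at distinct exponents, and an abscissa `t > 0` at which the branches `β_i(t) = Σ_l A_{i,l} t^{e_l}` are pairwise
distinct: at every zero `(t,b)` of the spectral polynomial `Φ` over `t`, both `∂_bΦ ≠ 0` and `H(Φ) ≠ 0` — the fibres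
`Φ(t,·)` and `H(Φ)(t,·)` have no common root. [folklore] -/
theorem diagonal_fibre_simple (m : ℕ) {K : ℕ} (e : Fin K → ℕ) (A : (Fin m ⊕ Fin 0) → Fin K → ℝ)
    (S : Fin K → Matrix (Fin m ⊕ Fin 0) (Fin m ⊕ Fin 0) ℝ) (hS : ∀ l, S l = Matrix.diagonal fun i => -A i l)
    (Φ : MvPolynomial (Fin 2) ℝ)
    (hΦ : Φ = (∑ l, (MvPolynomial.X (0 : Fin 2) : MvPolynomial (Fin 2) ℝ) ^ e l •
          (S l).map (MvPolynomial.C : ℝ →+* MvPolynomial (Fin 2) ℝ)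
        + (MvPolynomial.X (1 : Fin 2) : MvPolynomial (Fin 2) ℝ) •
          (Matrix.fromBlocks 1 0 0 0 : Matrix (Fin m ⊕ Fin 0) (Fin m ⊕ Fin 0) ℝ).map
            (MvPolynomial.C : ℝ →+* MvPolynomial (Fin 2) ℝ)).det)
    (hsign : ∀ i, ∃ l₁ l₂, e l₁ ≠ e l₂ ∧
      (((∀ l, 0 ≤ A i l) ∧ 0 < A i l₁ ∧ 0 < A i l₂) ∨ ((∀ l, A i l ≤ 0) ∧ A i l₁ < 0 ∧ A i l₂ < 0)))
    {t b : ℝ} (ht : 0 < t) (hsep : ∀ i j, i ≠ j → ∑ l, A i l * t ^ e l ≠ ∑ l, A j l * t ^ e l)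
    (hroot : MvPolynomial.eval ![t, b] Φ = 0) :
    MvPolynomial.eval ![t, b] (pderiv 1 Φ) ≠ 0 ∧
    MvPolynomial.eval ![t, b]
        (MvPolynomial.X 0 * MvPolynomial.pderiv 0 (MvPolynomial.X 0 * MvPolynomial.pderiv 0 Φ)
            * (MvPolynomial.X 1 * MvPolynomial.pderiv 1 Φ) ^ 2
          - 2 * (MvPolynomial.X 0 * MvPolynomial.pderiv 0 (MvPolynomial.X 1 * MvPolynomial.pderiv 1 Φ))
            * (MvPolynomial.X 0 * MvPolynomial.pderiv 0 Φ) * (MvPolynomial.X 1 * MvPolynomial.pderiv 1 Φ)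
          + MvPolynomial.X 1 * MvPolynomial.pderiv 1 (MvPolynomial.X 1 * MvPolynomial.pderiv 1 Φ)
            * (MvPolynomial.X 0 * MvPolynomial.pderiv 0 Φ) ^ 2) ≠ 0 := by
  -- the zero lies on a branch `b = β_i(t)`
  have hprod : ∏ j, (b - ∑ l, A j l * t ^ e l) = 0 := by
    have h := hroot
    rw [hΦ, eval_det_mvPencil_diagonal m e A S hS] at h
    simpa only [Matrix.cons_val_one, Matrix.cons_val_zero] using h
  obtain ⟨i, -, hi⟩ := Finset.prod_eq_zero_iff.1 hprod
  have hb : b = ∑ l, A i l * t ^ e l := sub_eq_zero.1 hi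
  -- the branch as a polynomial
  set f : ℝ[X] := ∑ l, Polynomial.C (A i l) * X ^ e l with hf
  have hfeval : ∀ s, f.eval s = ∑ l, A i l * s ^ e l := fun s => by
    rw [hf, eval_finsetSum]
    exact Finset.sum_congr rfl fun l _ => by rw [eval_mul, eval_C, eval_pow, eval_X]
  have hbf : b = f.eval t := by rw [hfeval, hb]
  -- `∂_bΦ(t, β_i t) = Π_{j≠i}(β_i − β_j)(t) ≠ 0`
  have hder := hasDerivAt_eval_det_mvPencil_diagonal m e A S hS t i
  rw [← hΦ] at hder
  have hder' := OsculationPeel.hasDerivAt_mvPolynomial_eval Φ (hasDerivAt_const (∑ l, A i l * t ^ e l) t)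
    (hasDerivAt_id' (∑ l, A i l * t ^ e l))
  have huniq := hder'.unique hder
  rw [mul_zero, zero_add, mul_one] at huniq
  have hΦb : MvPolynomial.eval ![t, ∑ l, A i l * t ^ e l] (pderiv 1 Φ) ≠ 0 := by
    rw [huniq]
    exact Finset.prod_ne_zero_iff.2 fun j hj => sub_ne_zero.2 (hsep i j (Finset.ne_of_mem_erase hj).symm)
  refine ⟨by rw [hb]; exact hΦb, ?_⟩
  -- the engine
  have hcurve : ∀ s ∈ Ioo 0 (t + 1), MvPolynomial.eval ![s, f.eval s] Φ = 0 := by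
    intro s _
    rw [hΦ, eval_det_mvPencil_diagonal m e A S hS]
    simp only [Matrix.cons_val_one, Matrix.cons_val_zero]
    exact Finset.prod_eq_zero (Finset.mem_univ i) (by rw [hfeval, sub_self])
  have hΦb' : MvPolynomial.eval ![t, f.eval t] (pderiv 1 Φ) ≠ 0 := by rw [hfeval]; exact hΦb
  have hmem : t ∈ Ioo 0 (t + 1) := ⟨ht, lt_add_one t⟩
  obtain ⟨l₁, l₂, he, hsg⟩ := hsign i
  have h := eval_logHessian_ne_zero_of_polynomial_branch Φ (A i) e hsg he hmem ht hcurve hΦb'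
  rw [hbf]
  exact h

/-- **Empty osculation set** for such a pencil (the line's osculation-set text with `Φ` abstracted). [folklore] -/
theorem osc_diagonal_eq_empty (m : ℕ) {K : ℕ} (e : Fin K → ℕ) (A : (Fin m ⊕ Fin 0) → Fin K → ℝ)
    (S : Fin K → Matrix (Fin m ⊕ Fin 0) (Fin m ⊕ Fin 0) ℝ) (hS : ∀ l, S l = Matrix.diagonal fun i => -A i l)
    (Φ : MvPolynomial (Fin 2) ℝ)
    (hΦ : Φ = (∑ l, (MvPolynomial.X (0 : Fin 2) : MvPolynomial (Fin 2) ℝ) ^ e l •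
          (S l).map (MvPolynomial.C : ℝ →+* MvPolynomial (Fin 2) ℝ)
        + (MvPolynomial.X (1 : Fin 2) : MvPolynomial (Fin 2) ℝ) •
          (Matrix.fromBlocks 1 0 0 0 : Matrix (Fin m ⊕ Fin 0) (Fin m ⊕ Fin 0) ℝ).map
            (MvPolynomial.C : ℝ →+* MvPolynomial (Fin 2) ℝ)).det)
    (hsign : ∀ i, ∃ l₁ l₂, e l₁ ≠ e l₂ ∧
      (((∀ l, 0 ≤ A i l) ∧ 0 < A i l₁ ∧ 0 < A i l₂) ∨ ((∀ l, A i l ≤ 0) ∧ A i l₁ < 0 ∧ A i l₂ < 0)))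
    (hsep : ∀ t, 0 < t → ∀ i j, i ≠ j → ∑ l, A i l * t ^ e l ≠ ∑ l, A j l * t ^ e l) :
    {p : Fin 2 → ℝ | 0 < p 0 ∧ 0 < p 1 ∧ MvPolynomial.eval p Φ = 0 ∧
      MvPolynomial.eval p
        (MvPolynomial.X 0 * MvPolynomial.pderiv 0 (MvPolynomial.X 0 * MvPolynomial.pderiv 0 Φ)
            * (MvPolynomial.X 1 * MvPolynomial.pderiv 1 Φ) ^ 2
          - 2 * (MvPolynomial.X 0 * MvPolynomial.pderiv 0 (MvPolynomial.X 1 * MvPolynomial.pderiv 1 Φ))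
            * (MvPolynomial.X 0 * MvPolynomial.pderiv 0 Φ) * (MvPolynomial.X 1 * MvPolynomial.pderiv 1 Φ)
          + MvPolynomial.X 1 * MvPolynomial.pderiv 1 (MvPolynomial.X 1 * MvPolynomial.pderiv 1 Φ)
            * (MvPolynomial.X 0 * MvPolynomial.pderiv 0 Φ) ^ 2) = 0} = ∅ := by
  refine Set.eq_empty_iff_forall_notMem.2 fun p hp => ?_
  obtain ⟨h0, -, hΦ0, hH0⟩ := hp
  have hp' : ![p 0, p 1] = p := by
    funext k; fin_cases k <;> rfl
  rw [← hp'] at hΦ0 hH0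
  exact (diagonal_fibre_simple m e A S hS Φ hΦ hsign h0 (hsep _ h0) hΦ0).2 hH0

/-! ### Separability of `Π_i (X^n + w_i)` -/

/-- Distinct translates `X^n + a`, `X^n + b` (`a ≠ b`) are coprime. [folklore] -/
theorem isCoprime_X_pow_add_C {n : ℕ} {a b : ℝ} (hab : a ≠ b) :
    IsCoprime (X ^ n + Polynomial.C a) (X ^ n + Polynomial.C b) := by
  have hne : a - b ≠ 0 := sub_ne_zero.2 hab
  refine ⟨Polynomial.C (a - b)⁻¹, -Polynomial.C (a - b)⁻¹, ?_⟩
  calc Polynomial.C (a - b)⁻¹ * (X ^ n + Polynomial.C a) + -Polynomial.C (a - b)⁻¹ * (X ^ n + Polynomial.C b)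
        = Polynomial.C ((a - b)⁻¹ * (a - b)) := by simp only [map_mul, map_sub]; ring
    _ = 1 := by rw [inv_mul_cancel₀ hne, map_one]

/-- `Π_i (X^n + w_i)` is separable for `n ≠ 0` and distinct nonzero `w_i`. [folklore] -/
theorem separable_prod_X_pow_add_C {ι : Type*} [Fintype ι] {n : ℕ} (hn : n ≠ 0) (w : ι → ℝ)
    (hw : ∀ i j, i ≠ j → w i ≠ w j) (hw0 : ∀ i, w i ≠ 0) : (∏ i, (X ^ n + Polynomial.C (w i))).Separable := by
  refine Polynomial.separable_prod (fun i j hij => isCoprime_X_pow_add_C (hw i j hij)) fun i => ?_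
  have h := Polynomial.separable_X_pow_sub_C (-w i) (by exact_mod_cast hn : (n : ℝ) ≠ 0) (neg_ne_zero.2 (hw0 i))
  rwa [map_neg, sub_neg_eq_add] at h

/-- `Π_i −(X^n + w_i)` is separable likewise. [folklore] -/
theorem separable_prod_neg_X_pow_add_C {ι : Type*} [Fintype ι] {n : ℕ} (hn : n ≠ 0) (w : ι → ℝ)
    (hw : ∀ i j, i ≠ j → w i ≠ w j) (hw0 : ∀ i, w i ≠ 0) : (∏ i, -(X ^ n + Polynomial.C (w i))).Separable := by
  refine Polynomial.separable_prod (fun i j hij => (isCoprime_X_pow_add_C (hw i j hij)).neg_neg) fun i => ?_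
  have h := Polynomial.separable_X_pow_sub_C (-w i) (by exact_mod_cast hn : (n : ℝ) ≠ 0) (neg_ne_zero.2 (hw0 i))
  rw [map_neg, sub_neg_eq_add] at h
  unfold Polynomial.Separable at h ⊢
  rw [derivative_neg]
  exact h.neg_neg

end OsculationRecursion

end Summit.ValiantsHypothesis.ValiantsHypothesis.Theorems.LacunarySymmetroidMatrixDescartes

end
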